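import Literature.AlgebraicGeometry.HodgeTheory.LefschetzStandardUnconditionalDegrees
import HarnessLib

/-!
# Crux `LefschetzStandardB` (stmt-HodgeConjecture-17489), line `birth` — stub 1 `stub_lowerHalf`:
# the LOWER HALF of Grothendieck's `B(X)` in André's `*_L`-form, for every smooth projective complex variety

Route `HodgeConjecture/MotivatedLefschetzSplit`, crux #3 `LefschetzStandardB := ∀ d Z η, IsSmoothProjective d Z →
StandardConjectureBStar d Z η`; registered skeleton `Cruxes/LefschetzStandardB/Lines/birth.lean`
(`LefschetzStandardB_of : Sig.stub_lowerHalf → Sig.stub_familySupply → Sig.stub_charlesSpread →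
Sig.stub_cayleyHamiltonTransfer → LefschetzStandardB`). This file closes the registered stub

* **`stub_lowerHalf`** (signature VERBATIM): for `Z` smooth projective of dimension `d`, a polarisation class `η`
  and degrees `a + b = 2d` with `a ≤ d`, the Lefschetz involution `*_L = L^{d-a} : Hᵃ(Z(ℂ); ℂ) → Hᵇ(Z(ℂ); ℂ)`
  is induced by an algebraic class on `Z × Z` — it is `x ↦ x ∪ η^{d-a} = [Δ_* η^{d-a}]^*` with `η^{d-a} ∈ N^{d-a}`
  (cup powers of the divisor-supported `η`, Voisin II Prop. 9.20, a theorem of the tree). On the carriers this is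
  the tree's Literature theorem `isAlgebraicCorrespondence_lefschetzInvolution_of_le`
  (`HodgeTheory/LefschetzStandardUnconditionalDegrees.lean`), so the stub is a one-term application;

and records, for the strong induction of `LefschetzStandardB_of`, the part of the all-varieties hypothesis of
`stub_charlesSpread` that is UNCONDITIONAL: `*_L : Hᵃ'(S) → Hᵇ'(S)` is algebraic for every smooth projective `S`
whenever `a' ≤ dim S` or `b' ≤ 1` (`lefschetzInvolution_algebraic_of_le_or_le_one`: the lower half, the degree
`b' = 0` and the degree `b' = 1` = Lefschetz `(1,1)` on `S × S` with hard Lefschetz, all tree theorems), hence the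
whole hypothesis in the first two stages `b ≤ 3` of the induction (`charlesSpread_hypothesis_of_le_three`).

Nothing here is a case of the Hodge conjecture or of `B(X)` above the middle degree; no definition, no named fact,
no sorry. References: [Andre1996Motifs] §0.2 (p. 7), §1.1 (p. 10), §3.2 Remarque (p. 21); [Grothendieck1968] §3
p. 196; [Kleiman1968AlgebraicCycles] §2; [VoisinHodgeII2003] §9.2.4 Prop. 9.20; [Voisin2025] §3.2.2 (15)–(16),
Conj. 3.11; [Charles2013] Prop. 8 (arXiv:1002.5011).
-/

noncomputable section

-- every declaration of this problem lives in `Summit.HodgeConjecture.HodgeConjecture.…` (summit = sub-problem)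
set_option linter.dupNamespace false

open CategoryTheory AlgebraicGeometry
open Literature.AlgebraicGeometry.Motives Literature.AlgebraicGeometry.HodgeTheory

namespace Summit.HodgeConjecture.HodgeConjecture.Theorems.LefschetzStandardB

/-- **Stub 1 of crux `LefschetzStandardB` — the lower half of `B` (registered signature, verbatim).** For `Z`
smooth projective of dimension `d`, a polarisation class `η` and `a + b = 2d` with `a ≤ d`, the Lefschetz
involution `*_L = L^{d-a} : Hᵃ(Z(ℂ); ℂ) → Hᵇ(Z(ℂ); ℂ)` (`lefschetzInvolution_apply_of_le`) is induced by an
algebraic correspondence: `x ↦ η^{d-a} ∪ x = x ∪ η^{d-a} = [Δ_* η^{d-a}]^* x`, `η^{d-a} ∈ N^{d-a} H^{2(d-a)}`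
(the tree's `isAlgebraicCorrespondence_lefschetzInvolution_of_le`). [cite: Andre1996Motifs, §1.1 (p. 10) and §3.2 Remarque (p. 21)]
[cite: Kleiman1968AlgebraicCycles, §2] [cite: Grothendieck1968, §3 p. 196 (B(X))] -/
theorem stub_lowerHalf :
    ∀ (d : ℕ) (Z : SchemeOver ℂ) (η : complexBetti Z 2), IsSmoothProjective d Z →
      ∀ (hη : IsPolarizationClass d Z η) (a b : ℕ) (hab : a + b = 2 * d), a ≤ d →
        IsAlgebraicCorrespondence d d Z Z (lefschetzInvolution hη.hasHardLefschetz hab) :=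
  fun _ _ _ hZ hη _ _ hab ha ↦ isAlgebraicCorrespondence_lefschetzInvolution_of_le hZ hη hab ha

/-- **The unconditional degrees of `B(S)`, for every smooth projective complex `S` of dimension `l` and every
polarisation class `κ`:** `*_L : Hᵃ'(S(ℂ); ℂ) → Hᵇ'(S(ℂ); ℂ)` (`a' + b' = 2l`) is induced by an algebraic
correspondence as soon as `a' ≤ l` (the lower half, `*_L = L^{l-a'}`) or `b' ≤ 1` (`b' = 0`: every linear map
`H^{2l} → H⁰` is algebraic; `b' = 1`: Lefschetz `(1,1)` on `S × S` and hard Lefschetz — the tree's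
`isAlgebraicCorrespondence_lefschetzInvolution_to_zero` / `_to_one`). [cite: Voisin2025, §3.2.2 (15)–(16) and Conj. 3.11]
[cite: Kleiman1968AlgebraicCycles, §2] -/
theorem lefschetzInvolution_algebraic_of_le_or_le_one {l : ℕ} {S : SchemeOver ℂ} {κ : complexBetti S 2}
    (hS : IsSmoothProjective l S) (hκ : IsPolarizationClass l S κ) (a' b' : ℕ) (hab' : a' + b' = 2 * l)
    (h : a' ≤ l ∨ b' ≤ 1) :
    IsAlgebraicCorrespondence l l S S (lefschetzInvolution hκ.hasHardLefschetz hab') := by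
  rcases le_or_gt a' l with ha | ha
  · exact isAlgebraicCorrespondence_lefschetzInvolution_of_le hS hκ hab' ha
  have hb : b' ≤ 1 := h.resolve_left (by omega)
  interval_cases b'
  · exact isAlgebraicCorrespondence_lefschetzInvolution_to_zero hS hκ hab' rfl
  · exact isAlgebraicCorrespondence_lefschetzInvolution_to_one hS hκ hab' rfl

/-- **The all-varieties hypothesis of `stub_charlesSpread` holds unconditionally in the first two stages `b ≤ 3`
of the strong induction of `LefschetzStandardB_of`** ("`B` below `b` for all varieties" = the lower half or a target
degree `b' ≤ b - 2 ≤ 1`): for every smooth projective `S`, every polarisation class `κ` and `a' + b' = 2 dim S` with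
`a' ≤ dim S ∨ b' + 2 ≤ b`, the Lefschetz involution `Hᵃ'(S) → Hᵇ'(S)` is an algebraic correspondence. So at
`b = 2` (Charles 2013 Thm. 1, the first battleground `d = 3`) and `b = 3` the spread criterion consumes no instance
of conjecture `B`. [cite: Charles2013, Prop. 8 and Lemma 7 (arXiv:1002.5011)] [cite: Voisin2025, §3.2.2 Conj. 3.11] -/
theorem charlesSpread_hypothesis_of_le_three {b : ℕ} (hb : b ≤ 3) :
    ∀ (l : ℕ) (S : SchemeOver ℂ) (κ : complexBetti S 2), IsSmoothProjective l S →
      ∀ (hκ : IsPolarizationClass l S κ) (a' b' : ℕ) (hab' : a' + b' = 2 * l),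
        a' ≤ l ∨ b' + 2 ≤ b →
        IsAlgebraicCorrespondence l l S S (lefschetzInvolution hκ.hasHardLefschetz hab') :=
  fun _ _ _ hS hκ a' b' hab' h ↦
    lefschetzInvolution_algebraic_of_le_or_le_one hS hκ a' b' hab' (h.imp_right fun h' ↦ by omega)

end Summit.HodgeConjecture.HodgeConjecture.Theorems.LefschetzStandardB

end
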